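import Summits.QuantumFields.QCD.Theorems.HeatSlicedQuarksInterleavedFlowProperStubDiagonalExtractionAnatomy
import Summits.QuantumFields.QCD.Theorems.HeatSlicedQuarksInterleavedFlowProperStubCoerciveFormatInstantiate
import Summits.QuantumFields.QCD.Theorems.HeatSlicedQuarksInterleavedFlowProperStubPolynomialFiniteRange
import Summits.QuantumFields.QCD.Theorems.HeatSlicedQuarksInterleavedHeatSliceFlowCollapse
import Summits.QuantumFields.QCD.Theorems.HeatSlicedQuarksTracedQuadraticParametrix
import Summits.QuantumFields.QCD.Theorems.HeatSlicedQuarksQuarkLoopCoefficient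

/-!
# Crux `InterleavedFlowProper` (stmt-QuantumFields-18031), line `Sketch` gen 4 — the line gives NO discount on X₀
# (kernel-checked form of lead c2's finding F6 "witness leakage"; continuation lead c3)

The registered gen-4 skeleton `Cruxes/InterleavedFlowProper/Lines/Sketch.lean` closes the crux modulo three stubs

* `S₁ = stub_blockFormat : ⟨Chebyshev finite range⟩ → TracedQuadraticParametrix → QuarkLoopCoefficient → CoerciveFormatMembership`,
* `S₂ = stub_robustYangMillsRG : NestedDissectionSea.RobustYangMillsRG` (item stmt-QuantumFields-17812 by name),
* `S₃ = stub_locallyUniformLimits : TracedQuadraticParametrix → QuarkLoopCoefficient → BlockGapAlongQCDWeight → LocallyUniformQCDLimits`.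

Both milestones are now THEOREMS of the tree (`TracedQuadraticParametrix_of`, item 17985; `QuarkLoopCoefficient_of`, item
16786), the KΩ′ target is ≡ X₀ (`locallyUniformQCDLimits_iff_continuumQCDExists`, p157171) and the crux is ≡ X₀
(`interleavedHeatSliceFlow_iff_continuumQCDExists`, p96451).  This file records, sorry-free and by pure logic over those
tree theorems, what the decomposition is worth:

* `interleavedFlowProper_iff_continuumQCDExists_now` — the crux ↔ `ContinuumQCDExists`, unconditionally;
* `stubLocallyUniformLimits_iff` — the registered type of `S₃` ↔ `BlockGapAlongQCDWeight → ContinuumQCDExists`;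
* `stubLocallyUniformLimits_iff_target` / `…_iff_crux` — GIVEN the output `BlockGapAlongQCDWeight` of stubs 1–2
  (`blockGap_of_stubs`), the last stub IS the route target X₀, i.e. IS the crux;
* `line_no_discount` — `S₁ ∧ S₂ ∧ S₃ ↔ S₁ ∧ S₂ ∧ ContinuumQCDExists`: modulo the two stubs that are themselves declared
  open problems (K1b: Bałaban format for a dynamical `SU(3)` field with the Wilson determinant; 17812: another route's
  crux), the third registered stub is exactly as strong as the crux it was meant to decompose.

Why the typing cannot do better (prose, for the planners; the Lean content is the four equivalences): the milestones
`CoerciveFormatMembership` / `BlockGapAlongQCDWeight` hide the regularisation behind `∃ reg` with `reg.mcrit`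
unconstrained, so they are inhabited — if at all — also by a super-heavy witness (bare masses above the hopping-expansion
threshold: positive, quasi-local determinant, decoupled quarks) that carries no information about the scaling regime; and
the YM-side conclusion pasted into `BlockGapAlongQCDWeight` clusters BLOCK GAUGE observables read through `Bl` only, while
X₀'s clauses (convergence of all `n`-point functions of the PERIODIC-quark functional, `SO(4)`, glue non-Gaussianity,
`IsNontrivial (pseudoRe f g)`) concern fine and fermionic observables.  Hence a proof of `S₃` must build X₀'s
regularisation and limits from scratch: the line is not reductive.  (Lead c3's line verdict and the specification of a
reductive re-lining are in `Cruxes/InterleavedFlowProper/Lines/Sketch.dead.md`.)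
-/

namespace Summit.QuantumFields.QCD.Cruxes.InterleavedFlowProper.OffsetLastFormatHandover

open Summit.QuantumFields.QCD.Theses.HeatSlicedQuarks
open Summit.QuantumFields.QCD.Theses (NestedDissectionSea.RobustYangMillsRG)
open Literature.MathematicalPhysics.QuantumFieldTheory Literature.MathematicalPhysics.QuantumLattice
  Literature.MathematicalPhysics.AQFT
open Literature.Probability.LatticeModels (TorusSite)
open scoped Matrix ComplexOrder

/-! ## §1 The crux is X₀ (the milestones are the tree theorems `TracedQuadraticParametrix_of`, `QuarkLoopCoefficient_of`) -/

/-- **The crux is now ≡ X₀ unconditionally**: `InterleavedFlowProper ↔ ContinuumQCDExists` (both milestones being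
theorems, the glue's hypotheses are idle; the parent glue collapsed onto X₀ in p96451). [folklore] -/
theorem interleavedFlowProper_iff_continuumQCDExists_now : InterleavedFlowProper ↔ ContinuumQCDExists :=
  ⟨fun h => Cruxes.InterleavedHeatSliceFlow.interleavedHeatSliceFlow_iff_continuumQCDExists.mp
      (h Cruxes.TracedQuadraticParametrix.Sketch.TracedQuadraticParametrix_of
        Cruxes.QuarkLoopCoefficient.Sketch.QuarkLoopCoefficient_of),
    fun hX _ _ => Cruxes.InterleavedHeatSliceFlow.interleavedHeatSliceFlow_iff_continuumQCDExists.mpr hX⟩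

/-! ## §2 The last registered stub is `BlockGapAlongQCDWeight → X₀` -/

/-- **The registered type of `stub_locallyUniformLimits` (KΩ′) is ↔ `BlockGapAlongQCDWeight → ContinuumQCDExists`**:
the milestones in front are theorems and the KΩ′ target is ≡ X₀ (p157171). [folklore] -/
theorem stubLocallyUniformLimits_iff :
    (TracedQuadraticParametrix → QuarkLoopCoefficient → BlockGapAlongQCDWeight → LocallyUniformQCDLimits) ↔
      (BlockGapAlongQCDWeight → ContinuumQCDExists) :=
  ⟨fun h hgap => locallyUniformQCDLimits_iff_continuumQCDExists.mp
      (h Cruxes.TracedQuadraticParametrix.Sketch.TracedQuadraticParametrix_of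
        Cruxes.QuarkLoopCoefficient.Sketch.QuarkLoopCoefficient_of hgap),
    fun h _ _ hgap => locallyUniformQCDLimits_iff_continuumQCDExists.mpr (h hgap)⟩

/-- X₀ proves the last stub outright (so the stub is at most as strong as the crux). [folklore] -/
theorem stubLocallyUniformLimits_of_continuumQCDExists (hX : ContinuumQCDExists) :
    TracedQuadraticParametrix → QuarkLoopCoefficient → BlockGapAlongQCDWeight → LocallyUniformQCDLimits :=
  fun _ _ _ => locallyUniformQCDLimits_of_continuumQCDExists hX

/-- **Given the block gap, the last stub IS the route target X₀.** [folklore] -/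
theorem stubLocallyUniformLimits_iff_target (hgap : BlockGapAlongQCDWeight) :
    (TracedQuadraticParametrix → QuarkLoopCoefficient → BlockGapAlongQCDWeight → LocallyUniformQCDLimits) ↔
      ContinuumQCDExists :=
  stubLocallyUniformLimits_iff.trans ⟨fun h => h hgap, fun hX _ => hX⟩

/-- **Given the block gap, the last stub IS the crux** it was meant to decompose. [folklore] -/
theorem stubLocallyUniformLimits_iff_crux (hgap : BlockGapAlongQCDWeight) :
    (TracedQuadraticParametrix → QuarkLoopCoefficient → BlockGapAlongQCDWeight → LocallyUniformQCDLimits) ↔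
      InterleavedFlowProper :=
  (stubLocallyUniformLimits_iff_target hgap).trans interleavedFlowProper_iff_continuumQCDExists_now.symm

/-! ## §3 The first two stubs deliver exactly the block gap, and nothing the third can use beyond it -/

/-- **Stubs 1–2 deliver `BlockGapAlongQCDWeight`** (the skeleton's own first two steps: the finite-range input is the
landed `stub_polynomialFiniteRange`, the milestones are theorems, the quantifier match is `coerciveFormat_instantiate`). [folklore] -/
theorem blockGap_of_stubs
    (h₁ : (∀ (L : ℕ) [NeZero L] (U : GaugeConfig 4 L (Matrix.specialUnitaryGroup (Fin 3) ℂ)) (m : ℝ)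
        (p : Polynomial ℂ) (x y : TorusSite 4 L × Fin 3 × Fin 4),
        2 * p.natDegree < torusDist x.1 y.1 →
          (Polynomial.aeval ((wilsonDirac (fundamentalRep (Fin 3)) U m 1)ᴴ * wilsonDirac (fundamentalRep (Fin 3)) U m 1) p)
            x y = 0) →
      TracedQuadraticParametrix → QuarkLoopCoefficient → CoerciveFormatMembership)
    (h₂ : NestedDissectionSea.RobustYangMillsRG) : BlockGapAlongQCDWeight :=
  coerciveFormat_instantiate h₂
    (h₁ stub_polynomialFiniteRange Cruxes.TracedQuadraticParametrix.Sketch.TracedQuadraticParametrix_of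
      Cruxes.QuarkLoopCoefficient.Sketch.QuarkLoopCoefficient_of)

/-- **The line gives no discount on X₀**: the conjunction of the three registered stubs of line `Sketch` (gen 4) is
equivalent to the conjunction of the first two with the route target itself.  Modulo K1b and 17812 — both declared open
problems in their own right — the third stub is exactly `ContinuumQCDExists`. [folklore] -/
theorem line_no_discount :
    ((∀ (L : ℕ) [NeZero L] (U : GaugeConfig 4 L (Matrix.specialUnitaryGroup (Fin 3) ℂ)) (m : ℝ)
        (p : Polynomial ℂ) (x y : TorusSite 4 L × Fin 3 × Fin 4),
        2 * p.natDegree < torusDist x.1 y.1 →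
          (Polynomial.aeval ((wilsonDirac (fundamentalRep (Fin 3)) U m 1)ᴴ * wilsonDirac (fundamentalRep (Fin 3)) U m 1) p)
            x y = 0) →
      TracedQuadraticParametrix → QuarkLoopCoefficient → CoerciveFormatMembership) ∧
    NestedDissectionSea.RobustYangMillsRG ∧
    (TracedQuadraticParametrix → QuarkLoopCoefficient → BlockGapAlongQCDWeight → LocallyUniformQCDLimits) ↔
    ((∀ (L : ℕ) [NeZero L] (U : GaugeConfig 4 L (Matrix.specialUnitaryGroup (Fin 3) ℂ)) (m : ℝ)
        (p : Polynomial ℂ) (x y : TorusSite 4 L × Fin 3 × Fin 4),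
        2 * p.natDegree < torusDist x.1 y.1 →
          (Polynomial.aeval ((wilsonDirac (fundamentalRep (Fin 3)) U m 1)ᴴ * wilsonDirac (fundamentalRep (Fin 3)) U m 1) p)
            x y = 0) →
      TracedQuadraticParametrix → QuarkLoopCoefficient → CoerciveFormatMembership) ∧
    NestedDissectionSea.RobustYangMillsRG ∧ ContinuumQCDExists :=
  ⟨fun ⟨h₁, h₂, h₃⟩ => ⟨h₁, h₂, (stubLocallyUniformLimits_iff_target (blockGap_of_stubs h₁ h₂)).mp h₃⟩,
    fun ⟨h₁, h₂, hX⟩ => ⟨h₁, h₂, stubLocallyUniformLimits_of_continuumQCDExists hX⟩⟩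

/-- **Corollary (the shape the planners should read)**: once stubs 1–2 hold, proving stub 3 and proving the crux are the
same task. [folklore] -/
theorem stubLocallyUniformLimits_iff_crux_of_stubs
    (h₁ : (∀ (L : ℕ) [NeZero L] (U : GaugeConfig 4 L (Matrix.specialUnitaryGroup (Fin 3) ℂ)) (m : ℝ)
        (p : Polynomial ℂ) (x y : TorusSite 4 L × Fin 3 × Fin 4),
        2 * p.natDegree < torusDist x.1 y.1 →
          (Polynomial.aeval ((wilsonDirac (fundamentalRep (Fin 3)) U m 1)ᴴ * wilsonDirac (fundamentalRep (Fin 3)) U m 1) p)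
            x y = 0) →
      TracedQuadraticParametrix → QuarkLoopCoefficient → CoerciveFormatMembership)
    (h₂ : NestedDissectionSea.RobustYangMillsRG) :
    (TracedQuadraticParametrix → QuarkLoopCoefficient → BlockGapAlongQCDWeight → LocallyUniformQCDLimits) ↔
      InterleavedFlowProper :=
  stubLocallyUniformLimits_iff_crux (blockGap_of_stubs h₁ h₂)

end Summit.QuantumFields.QCD.Cruxes.InterleavedFlowProper.OffsetLastFormatHandover
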